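import Summits.AnomalousDissipation.AnomalousDissipation.Theorems.SolenoidalFractalHomogenisationRealisedQuasiStaticCellLawAnySlotInputs
import Summits.AnomalousDissipation.AnomalousDissipation.Theorems.SolenoidalFractalHomogenisationRealisedQuasiStaticCellLawUpperSomeWeights
import Summits.AnomalousDissipation.AnomalousDissipation.Theorems.SolenoidalFractalHomogenisationRealisedQuasiStaticCellLawOutOfPlaneLadder
import Summits.AnomalousDissipation.AnomalousDissipation.Theorems.SolenoidalFractalHomogenisationRealisedQuasiStaticCellLawCellLadder
import Summits.AnomalousDissipation.AnomalousDissipation.Theorems.SolenoidalFractalHomogenisationRealisedQuasiStaticCellLawWeakFarSlotAlgebra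
import Summits.AnomalousDissipation.AnomalousDissipation.Theorems.SolenoidalFractalHomogenisationRealisedQuasiStaticCellLawCellSlotFormulas
import HarnessLib

/-!
# K2R `RealisedQuasiStaticCellLaw`, line `floquet-bloch`, stub `stub_upperSome`: the frames of all slots in the Galerkin
# vocabulary (helper; `--supports stmt-AnomalousDissipation-20446`)

Summits-side helper file (everything proved; no definitions, no named facts). For a lattice word `W`, a cell size `n`,
a sector `ℓ ≠ 0` with `8‖ℓ‖ ≤ ‖K_j‖` (`K_j = n m_j`) on every slot and a Galerkin radius `N` whose ball contains
`ℓ, ℓ ± K_j`, `upperSome_frames` packages, slot by slot, the geometric inputs of `upperSome_galerkin_lower`: the real unit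
normal `ζ_j ⊥ ℓ, K_j`, the in-plane frame `p_{j,J} = |k_J|⁻¹ k_J × ζ_j`, the coset window `Wset_j = {J : ℓ + JK_j ∈ ball}`,
no zero / opposite frequencies on the coset, the link bound `|p_J·p_{J+1}| ≤ 1`, the diagonal gap `7/16`, `d₀ ≤ 1/16`,
`d_{±1} ≤ 2`, and the slaving-weight upper bounds `σ_o ≤ 2 + 2‖ℓ‖/‖K_j‖`, `σ_i ≤ 2cos² + 26‖ℓ‖/‖K_j‖`
(the isotropic exponent sum in the same vocabulary is `upperSome_iso` in the sibling file `…UpperSomeIso.lean`).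
This is NOT a proof of Onsager's conjecture nor of anomalous dissipation.
-/

set_option linter.dupNamespace false

noncomputable section

namespace Summit.AnomalousDissipation.AnomalousDissipation.Theorems.SolenoidalFractalHomogenisation.RealisedQuasiStaticCellLaw

open Matrix Complex
open scoped Matrix InnerProductSpace RealInnerProductSpace ComplexConjugate BigOperators
open Literature.Analysis Literature.Analysis.FunctionSpaces Literature.Analysis.FunctionSpaces.Torus
open Literature.Analysis.FluidPDE Literature.Analysis.FluidPDE.LatticeShear

variable {k₀ : ℕ}

/-- The two slaving weights are bounded below: `1 ≤ σ_o` and `γ²/2 ≤ σ_i` (both diagonal gaps lie in `(0, 2]`). -/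
theorem slaving_weights_lower {d₀ d₁ dm s₀ sm : ℝ} (h1 : d₀ < d₁) (h1' : d₁ - d₀ ≤ 2) (hm : d₀ < dm)
    (hm' : dm - d₀ ≤ 2) :
    1 ≤ 1 / (dm - d₀) + 1 / (d₁ - d₀) ∧
      (s₀ ^ 2 + sm ^ 2) / 2 ≤ sm ^ 2 / (dm - d₀) + s₀ ^ 2 / (d₁ - d₀) := by
  have ha : 0 < dm - d₀ := by linarith
  have hb : 0 < d₁ - d₀ := by linarith
  have h2 : 1 / 2 ≤ 1 / (dm - d₀) := one_div_le_one_div_of_le ha hm'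
  have h3 : 1 / 2 ≤ 1 / (d₁ - d₀) := one_div_le_one_div_of_le hb h1'
  refine ⟨by linarith, ?_⟩
  have h4 : sm ^ 2 / 2 ≤ sm ^ 2 / (dm - d₀) := by
    rw [div_eq_mul_one_div, div_eq_mul_one_div (sm ^ 2)]
    exact mul_le_mul_of_nonneg_left h2 (sq_nonneg _)
  have h5 : s₀ ^ 2 / 2 ≤ s₀ ^ 2 / (d₁ - d₀) := by
    rw [div_eq_mul_one_div, div_eq_mul_one_div (s₀ ^ 2)]
    exact mul_le_mul_of_nonneg_left h3 (sq_nonneg _)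
  linarith

/-- **The frames of all slots.** See the module docstring. -/
theorem upperSome_frames (W : LatticeWord k₀) {n : ℕ} (hn : 0 < n) {ℓ : Fin 3 → ℤ} (hℓ : ℓ ≠ 0)
    (h8 : ∀ j, 8 * ‖latticeVec ℓ‖ ≤ ‖latticeVec (fun i => (W.phase j).m i * (n : ℤ))‖) (N : ℕ)
    (hN : ∀ j, ∀ J : ℤ, |J| ≤ 1 → ℓ + J • (fun i => (W.phase j).m i * (n : ℤ)) ∈ freqBall N) :
    ∃ ζr : Fin k₀ → Fin 3 → ℝ, ∃ pf : Fin k₀ → ℤ → Fin 3 → ℝ, ∃ Wset : Fin k₀ → Finset ℤ,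
      (∀ j : Fin k₀, ∀ J : ℤ, ℓ + J • (fun i => (W.phase j).m i * (n : ℤ)) ∈ freqBall N →
        ℓ + J • (fun i => (W.phase j).m i * (n : ℤ)) ≠ 0) ∧
      (∀ j : Fin k₀, ∀ J J' : ℤ,
        ℓ + J • (fun i => (W.phase j).m i * (n : ℤ)) ≠ -(ℓ + J' • (fun i => (W.phase j).m i * (n : ℤ)))) ∧
      (∀ j, ζr j ⬝ᵥ ζr j = 1) ∧ (∀ j, ζr j ⬝ᵥ (fun i => ((ℓ i : ℤ) : ℝ)) = 0) ∧
      (∀ j, ζr j ⬝ᵥ (fun i => (((fun i => (W.phase j).m i * (n : ℤ)) i : ℤ) : ℝ)) = 0) ∧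
      (∀ j, ζr j ⬝ᵥ (fun i => (((W.phase j).m i : ℤ) : ℝ)) = 0) ∧
      (∀ j, ∀ J : ℤ, pf j J = (Real.sqrt ((fun i => (((ℓ + J • (fun i => (W.phase j).m i * (n : ℤ))) i : ℤ) : ℝ)) ⬝ᵥ
        (fun i => (((ℓ + J • (fun i => (W.phase j).m i * (n : ℤ))) i : ℤ) : ℝ))))⁻¹ •
        (fun i => (((ℓ + J • (fun i => (W.phase j).m i * (n : ℤ))) i : ℤ) : ℝ)) ⨯₃ ζr j) ∧
      (∀ j, ∀ J : ℤ, J ∈ Wset j ↔ ℓ + J • (fun i => (W.phase j).m i * (n : ℤ)) ∈ freqBall N) ∧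
      (∀ j, (0 : ℤ) ∈ Wset j) ∧ (∀ j, (1 : ℤ) ∈ Wset j) ∧ (∀ j, (-1 : ℤ) ∈ Wset j) ∧
      (∀ j, ∀ J : ℤ, |pf j J ⬝ᵥ pf j (J + 1)| ≤ 1) ∧
      (∀ j, ∀ J : ℤ, J ≠ 0 →
        freqNormSq ℓ / freqNormSq (fun i => (W.phase j).m i * (n : ℤ)) + 7 / 16 ≤
          freqNormSq (ℓ + J • (fun i => (W.phase j).m i * (n : ℤ))) / freqNormSq (fun i => (W.phase j).m i * (n : ℤ))) ∧
      (∀ j, freqNormSq ℓ / freqNormSq (fun i => (W.phase j).m i * (n : ℤ)) ≤ 1 / 16) ∧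
      (∀ j, freqNormSq (ℓ + (1 : ℤ) • (fun i => (W.phase j).m i * (n : ℤ))) /
        freqNormSq (fun i => (W.phase j).m i * (n : ℤ)) ≤ 2) ∧
      (∀ j, freqNormSq (ℓ + (-1 : ℤ) • (fun i => (W.phase j).m i * (n : ℤ))) /
        freqNormSq (fun i => (W.phase j).m i * (n : ℤ)) ≤ 2) ∧
      (∀ j, 1 / (freqNormSq (ℓ + (-1 : ℤ) • (fun i => (W.phase j).m i * (n : ℤ))) /
            freqNormSq (fun i => (W.phase j).m i * (n : ℤ)) - freqNormSq ℓ / freqNormSq (fun i => (W.phase j).m i * (n : ℤ))) +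
          1 / (freqNormSq (ℓ + (1 : ℤ) • (fun i => (W.phase j).m i * (n : ℤ))) /
            freqNormSq (fun i => (W.phase j).m i * (n : ℤ)) - freqNormSq ℓ / freqNormSq (fun i => (W.phase j).m i * (n : ℤ))) ≤
        2 + 2 * (‖latticeVec ℓ‖ / ‖latticeVec (fun i => (W.phase j).m i * (n : ℤ))‖)) ∧
      (∀ j, (pf j (-1) ⬝ᵥ pf j 0) ^ 2 / (freqNormSq (ℓ + (-1 : ℤ) • (fun i => (W.phase j).m i * (n : ℤ))) /
            freqNormSq (fun i => (W.phase j).m i * (n : ℤ)) - freqNormSq ℓ / freqNormSq (fun i => (W.phase j).m i * (n : ℤ))) +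
          (pf j 0 ⬝ᵥ pf j 1) ^ 2 / (freqNormSq (ℓ + (1 : ℤ) • (fun i => (W.phase j).m i * (n : ℤ))) /
            freqNormSq (fun i => (W.phase j).m i * (n : ℤ)) - freqNormSq ℓ / freqNormSq (fun i => (W.phase j).m i * (n : ℤ))) ≤
        2 * (((fun i => ((ℓ i : ℤ) : ℝ)) ⬝ᵥ (fun i => (((fun i => (W.phase j).m i * (n : ℤ)) i : ℤ) : ℝ))) ^ 2 /
          (freqNormSq ℓ * freqNormSq (fun i => (W.phase j).m i * (n : ℤ)))) +
          26 * (‖latticeVec ℓ‖ / ‖latticeVec (fun i => (W.phase j).m i * (n : ℤ))‖)) := by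
  classical
  have hn' : (0 : ℝ) < n := by exact_mod_cast hn
  -- slot by slot
  have h4 : ∀ j, 4 * ‖latticeVec ℓ‖ ≤ ‖latticeVec (fun i => (W.phase j).m i * (n : ℤ))‖ := fun j => by
    have := h8 j; nlinarith [norm_nonneg (latticeVec ℓ)]
  have hslot := fun j => anySlot_inputs (W.phase j) hn hℓ (h4 j)
  choose ζr pf hk hdisj hζ1 hζ0 hζK hp hs hd0 hgap hd1 hdm1 using hslot
  obtain ⟨Wset, hW⟩ : ∃ Wset : Fin k₀ → Finset ℤ, ∀ j, ∀ J : ℤ,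
      J ∈ Wset j ↔ ℓ + J • (fun i => (W.phase j).m i * (n : ℤ)) ∈ freqBall N := by
    have h := fun j => exists_cosetIndexSet (cellFreq_ne_zero (W.phase j) hn) ℓ N
    choose Wset hW using h
    exact ⟨Wset, hW⟩
  have hζm : ∀ j, ζr j ⬝ᵥ (fun i => (((W.phase j).m i : ℤ) : ℝ)) = 0 := by
    intro j
    have h := hζK j
    have e : (fun i => (((fun i => (W.phase j).m i * (n : ℤ)) i : ℤ) : ℝ)) =
        (n : ℝ) • (fun i => (((W.phase j).m i : ℤ) : ℝ)) := by
      funext i; simp [mul_comm]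
    rw [e, dotProduct_smul, smul_eq_mul] at h
    rcases mul_eq_zero.1 h with h0 | h0
    · exact absurd h0 hn'.ne'
    · exact h0
  have hwu := fun j => slaving_weights_upper ℓ (fun i => (W.phase j).m i * (n : ℤ)) hℓ (cellFreq_ne_zero (W.phase j) hn)
    (h8 j) (hζ1 j) (hζ0 j) (hζK j) (hp j)
  refine ⟨ζr, pf, Wset, fun j J _ => hk j J, hdisj, hζ1, hζ0, hζK, hζm, hp, hW,
    fun j => (hW j 0).2 (hN j 0 (by norm_num)), fun j => (hW j 1).2 (hN j 1 (by norm_num)),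
    fun j => (hW j (-1)).2 (hN j (-1) (by norm_num)), hs, hgap, hd0, hd1, hdm1, fun j => (hwu j).1, fun j => (hwu j).2⟩

end Summit.AnomalousDissipation.AnomalousDissipation.Theorems.SolenoidalFractalHomogenisation.RealisedQuasiStaticCellLaw

end
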